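import Literature.NumberTheory.EllipticCurves.YanZhu2026.GreenbergDivisibilityProofs
import Literature.NumberTheory.LFunctions.DworkRationalitySplittingSeries
import HarnessLib

/-!
# Route `SignedLowerHalves`, crux `KobayashiMainConjectureSmallImage` (item stmt-BirchSwinnertonDyer-19002):
# the two-variable GAUSS INEQUALITY over `𝒪_{ℂ_p}` — tool of the rational rigidity of the acns / acanchor glue
# (cell `bsd-ssimc`, seat `bsd-line-slh-p3` gen 6; THEOREMS ONLY, route-independent algebra; helper `--supports` item 4)

Companion `…SmallImageRationalRigidity.lean` turns the RATIONAL two-variable Euler-system inclusion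
(`β·G ∈ ch·𝒪⟦T₁,T₂⟧`, `β ∈ 𝒪_{ℂ_p}` a nonzero constant) plus the anticyclotomic anchor and `μ(G⁻) = 0` into
the INTEGRAL Eisenstein inclusion `ch·𝒪 ⊆ (G)`. Its one tool is proved here:

**`norm_coeff_mul_norm_coeff_le`** — in `𝒪_{ℂ_p}⟦T₂⟧⟦T₁⟧`, if every coefficient of `F·G` has norm `≤ b`,
then `‖F_{kl}‖·‖G_{mn}‖ ≤ b` for ALL pairs of coefficients ("content is multiplicative", stated without a
content function: over the non-discrete valuation ring `𝒪_{ℂ_p}` the supremum of the coefficient norms need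
not be attained, and `𝒪_{ℂ_p}⟦T₂⟧⟦T₁⟧` is not factorial). Proof: rescale both variables by `ϖ` with
`ϖ^N = p` (`ℂ_p` is algebraically closed, §1), so that the weighted norms `‖ϖ‖^{i+j}‖F_{ij}‖ → 0` attain
their maximum and `F(ϖT₁,ϖT₂) = γ·F'` with `F'` integral having a coefficient `1` (`exists_normalisation`);
the reduction of `F'·G'` modulo the maximal ideal is a product of nonzero elements of the DOMAIN
`𝔽̄_p⟦T₂⟧⟦T₁⟧`, so `F'·G'` has a unit coefficient, whence `‖ϖ‖^{k+l+m+n}‖F_{kl}‖‖G_{mn}‖ ≤ ‖γ‖‖δ‖ ≤ b`;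
finally `N → ∞` (`‖ϖ‖ = p^{-1/N} → 1`). One-variable case `norm_coeff_mul_norm_coeff_le₁` (the line
`T₁ = 0`) by embedding as `T₁`-constants.

HONEST SCOPE: pure commutative algebra; nothing about any curve is asserted; crux 4 OPEN; BSD is not proved
by any of this.

References: [BourbakiAC5to7] Ch. VII §3 (content, Gauss's lemma — here over a rank-one non-discrete
valuation ring, replaced by the rescaling argument); [Rubin2000] Thm. 2.3.3 (why Euler systems give the
inclusion only up to `p^t` without the τ-hypothesis — the consumer's motivation).
-/

-- D-0017: single-problem summit, the namespace repeats the problem name by design.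
set_option linter.dupNamespace false
set_option autoImplicit false

noncomputable section

open scoped Classical

namespace Summit.BirchSwinnertonDyer.BirchSwinnertonDyer.Theorems.SmallImageGaussInequality

open PowerSeries Literature.NumberTheory.EllipticCurves Literature.NumberTheory.EllipticCurves.GreenbergVatsal2000
  Literature.NumberTheory.EllipticCurves.UnrSeries₂

variable {p : ℕ} [Fact p.Prime]

/-! ## §1 Norm bookkeeping in `𝒪_{ℂ_p}`: roots of `p`, and the two-variable rescaling `T_i ↦ ϖ T_i` -/

/-- **Roots of `p` in `𝒪_{ℂ_p}`**: for `N ≥ 1` there is `ϖ ∈ 𝒪_{ℂ_p}` with `ϖ^N = p`, hence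
`0 < ‖ϖ‖ < 1` and `‖ϖ‖^N = p⁻¹` (`ℂ_p` is algebraically closed). [folklore] -/
theorem exists_root_of_p (N : ℕ) (hN : 0 < N) :
    ∃ ϖ : PadicComplexInt p, ‖(ϖ : ℂ_[p])‖ ^ N = (p : ℝ)⁻¹ ∧ 0 < ‖(ϖ : ℂ_[p])‖ ∧ ‖(ϖ : ℂ_[p])‖ < 1 := by
  obtain ⟨z, hz⟩ := IsAlgClosed.exists_pow_nat_eq (p : ℂ_[p]) hN
  have hpR : 1 < (p : ℝ) := by exact_mod_cast (Fact.out : p.Prime).one_lt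
  have hzN : ‖z‖ ^ N = (p : ℝ)⁻¹ := by rw [← norm_pow, hz, Literature.NumberTheory.LFunctions.Dwork.norm_natCast_p_padicComplex]
  have hlt1 : (p : ℝ)⁻¹ < 1 := inv_lt_one_of_one_lt₀ hpR
  have hpos : 0 < (p : ℝ)⁻¹ := by positivity
  have hz1 : ‖z‖ < 1 := by
    refine lt_of_not_ge fun h ↦ ?_
    have : (1 : ℝ) ≤ ‖z‖ ^ N := one_le_pow₀ h
    linarith
  have hz0 : 0 < ‖z‖ := by
    have : ‖z‖ ≠ 0 := fun h0 ↦ by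
      rw [h0, zero_pow (by omega)] at hzN
      linarith
    positivity
  exact ⟨⟨z, mem_padicComplexInt_iff.mpr hz1.le⟩, hzN, hz0, hz1⟩

/-- Coefficients of the two-variable rescaling `F(T₁, T₂) ↦ F(ϖT₁, ϖT₂)` (the ring homomorphism
`rescale (C ϖ) ∘ map (rescale ϖ)` of `𝒪⟦T₂⟧⟦T₁⟧`): `[T₁^i T₂^j] ↦ ϖ^i ϖ^j [T₁^i T₂^j]`. [folklore] -/
theorem coeff_coeff_rescale₂ (ϖ : PadicComplexInt p) (F : PowerSeries (PowerSeries (PadicComplexInt p)))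
    (i j : ℕ) :
    coeff j (coeff i (((rescale (C ϖ)).comp (PowerSeries.map (rescale ϖ))) F)) =
      ϖ ^ i * ϖ ^ j * coeff j (coeff i F) := by
  simp only [RingHom.coe_comp, Function.comp_apply, coeff_rescale, coeff_map, ← map_pow, coeff_C_mul,
    mul_assoc]

/-- Coefficients of `C (C γ) · F`: `[T₁^i T₂^j] (C(Cγ)·F) = γ · [T₁^i T₂^j] F`. [folklore] -/
theorem coeff_coeff_C_C_mul (γ : PadicComplexInt p) (F : PowerSeries (PowerSeries (PadicComplexInt p)))
    (i j : ℕ) : coeff j (coeff i (C (C γ) * F)) = γ * coeff j (coeff i F) := by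
  rw [coeff_C_mul, coeff_C_mul]

/-- Norm of a coefficient of `𝒪_{ℂ_p}` is positive iff the coefficient is nonzero. [folklore] -/
theorem norm_pos_of_ne_zero {x : PadicComplexInt p} (hx : x ≠ 0) : 0 < ‖(x : ℂ_[p])‖ :=
  norm_pos_iff.mpr fun h ↦ hx (Subtype.ext h)

/-- **Normalisation after rescaling.** For `0 < ‖ϖ‖ < 1` and `F` with a nonzero coefficient `F_{kl}`: the
rescaled series `F(ϖT₁, ϖT₂)` is `γ · F'` with `γ ∈ 𝒪_{ℂ_p}` a weighted coefficient of MAXIMAL norm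
(`‖ϖ‖^{k+l}‖F_{kl}‖ ≤ ‖γ‖`) and `F'` integral with SOME coefficient equal to `1` (the weighted norms
`‖ϖ‖^{i+j}‖F_{ij}‖` tend to `0`, so the maximum is attained; `𝒪_{ℂ_p}` is a valuation ring, so `γ` divides
every rescaled coefficient). [folklore] -/
theorem exists_normalisation {ϖ : PadicComplexInt p} (h0 : 0 < ‖(ϖ : ℂ_[p])‖) (h1 : ‖(ϖ : ℂ_[p])‖ < 1)
    (F : PowerSeries (PowerSeries (PadicComplexInt p))) (k l : ℕ) (hF : coeff l (coeff k F) ≠ 0) :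
    ∃ (γ : PadicComplexInt p) (F' : PowerSeries (PowerSeries (PadicComplexInt p))),
      ((rescale (C ϖ)).comp (PowerSeries.map (rescale ϖ))) F = C (C γ) * F' ∧
      ‖(ϖ : ℂ_[p])‖ ^ (k + l) * ‖((coeff l (coeff k F) : PadicComplexInt p) : ℂ_[p])‖ ≤ ‖(γ : ℂ_[p])‖ ∧
      ∃ i j, coeff j (coeff i F') = 1 := by
  -- weighted coefficient norms
  set w : ℕ × ℕ → ℝ := fun ij ↦
    ‖(ϖ : ℂ_[p])‖ ^ (ij.1 + ij.2) * ‖((coeff ij.2 (coeff ij.1 F) : PadicComplexInt p) : ℂ_[p])‖ with hw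
  have hwnn : ∀ ij, 0 ≤ w ij := fun ij ↦ mul_nonneg (pow_nonneg (norm_nonneg _) _) (norm_nonneg _)
  have hwle : ∀ ij : ℕ × ℕ, w ij ≤ ‖(ϖ : ℂ_[p])‖ ^ (ij.1 + ij.2) := fun ij ↦
    mul_le_of_le_one_right (pow_nonneg (norm_nonneg _) _) (norm_coe_padicComplexInt_le_one _)
  have ht : 0 < w (k, l) := mul_pos (pow_pos h0 _) (norm_pos_of_ne_zero hF)
  obtain ⟨D, hD⟩ := exists_pow_lt_of_lt_one ht h1
  -- the finite box outside which the weighted norms are `< w (k,l)`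
  set S : Finset (ℕ × ℕ) := Finset.range D ×ˢ Finset.range D with hS
  have hanti : ∀ {a b : ℕ}, a ≤ b → ‖(ϖ : ℂ_[p])‖ ^ b ≤ ‖(ϖ : ℂ_[p])‖ ^ a := fun hab ↦
    pow_le_pow_of_le_one (norm_nonneg _) h1.le hab
  have hout : ∀ ij : ℕ × ℕ, ij ∉ S → w ij < w (k, l) := by
    intro ij hij
    have hD' : D ≤ ij.1 + ij.2 := by
      simp only [hS, Finset.mem_product, Finset.mem_range, not_and_or, not_lt] at hij
      omega
    exact lt_of_le_of_lt ((hwle ij).trans (hanti hD')) hD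
  have hkl : (k, l) ∈ S := by
    by_contra h
    exact lt_irrefl _ (hout _ h)
  obtain ⟨⟨i₁, j₁⟩, -, hmax⟩ := S.exists_max_image w ⟨(k, l), hkl⟩
  have hglob : ∀ i j, w (i, j) ≤ w (i₁, j₁) := by
    intro i j
    by_cases hij : (i, j) ∈ S
    · exact hmax _ hij
    · exact ((hout _ hij).le).trans (hmax _ hkl)
  -- the maximal weighted coefficient
  set γ : PadicComplexInt p := ϖ ^ (i₁ + j₁) * coeff j₁ (coeff i₁ F) with hγ
  have hγn : ‖(γ : ℂ_[p])‖ = w (i₁, j₁) := by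
    simp only [hγ, hw]
    push_cast
    rw [norm_mul, norm_pow]
  have hγ0 : γ ≠ 0 := by
    intro h
    have : w (i₁, j₁) = 0 := by rw [← hγn, h]; simp
    linarith [hmax _ hkl]
  -- `γ` divides every rescaled coefficient
  have hdvd : ∀ i j, γ ∣ ϖ ^ (i + j) * coeff j (coeff i F) := fun i j ↦ by
    refine padicComplexInt_dvd_of_norm_le ?_
    rw [hγn]
    push_cast
    rw [norm_mul, norm_pow]
    exact hglob i j
  choose q hq using hdvd
  refine ⟨γ, PowerSeries.mk fun i ↦ PowerSeries.mk fun j ↦ q i j, ?_, ?_, i₁, j₁, ?_⟩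
  · ext i j
    rw [coeff_coeff_rescale₂, coeff_coeff_C_C_mul, coeff_mk, coeff_mk, ← hq, pow_add]
  · rw [hγn]
    exact hglob k l
  · rw [coeff_mk, coeff_mk]
    have h1' : γ * q i₁ j₁ = γ * 1 := by rw [mul_one, ← hq]
    exact mul_left_cancel₀ hγ0 h1'


/-! ## §2 The two-variable Gauss inequality over `𝒪_{ℂ_p}` -/

/-- A two-variable series over `𝒪_{ℂ_p}` with a coefficient equal to `1` has nonzero reduction in
`𝔽̄_p⟦T₂⟧⟦T₁⟧` (reduction modulo the maximal ideal of `𝒪_{ℂ_p}`). [folklore] -/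
theorem map_residue_ne_zero_of_coeff_eq_one {F : PowerSeries (PowerSeries (PadicComplexInt p))} {i j : ℕ}
    (h : coeff j (coeff i F) = 1) :
    PowerSeries.map (PowerSeries.map (IsLocalRing.residue (PadicComplexInt p))) F ≠ 0 := by
  intro h0
  have h' := congr_arg (fun H ↦ coeff j (coeff i H)) h0
  simp only [coeff_map, h, map_one, map_zero] at h'
  exact one_ne_zero h'

/-- A nonzero two-variable series has a nonzero coefficient. [folklore] -/
theorem exists_coeff_coeff_ne_zero {R : Type*} [Semiring R] {H : PowerSeries (PowerSeries R)}
    (hH : H ≠ 0) : ∃ a b, coeff b (coeff a H) ≠ 0 := by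
  by_contra hcon
  simp only [not_exists, not_not] at hcon
  exact hH (PowerSeries.ext fun a ↦ PowerSeries.ext fun b ↦ by rw [hcon a b]; simp)

/-- **The two-variable Gauss inequality over the rank-one valuation ring `𝒪_{ℂ_p}`.** If every
coefficient of `F · G ∈ 𝒪_{ℂ_p}⟦T₂⟧⟦T₁⟧` has norm `≤ b`, then `‖F_{kl}‖ · ‖G_{mn}‖ ≤ b` for ALL pairs of
coefficients (the content of a product is the product of the contents — stated without a content
function, whose supremum need not be attained over `𝒪_{ℂ_p}`). Proof: rescale `T_i ↦ ϖ T_i` with `ϖ^N = p`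
(§1), normalise both factors to have a coefficient `1`, read a unit coefficient of the normalised product
off the domain `𝔽̄_p⟦T₂⟧⟦T₁⟧`, and let `N → ∞`.
[cite: BourbakiAC5to7, Ch. VII §3 (content and Gauss's lemma; here over a non-discrete valuation ring)] -/
theorem norm_coeff_mul_norm_coeff_le (F G : PowerSeries (PowerSeries (PadicComplexInt p))) {b : ℝ}
    (h : ∀ i j, ‖((coeff j (coeff i (F * G)) : PadicComplexInt p) : ℂ_[p])‖ ≤ b) (k l m n : ℕ) :
    ‖((coeff l (coeff k F) : PadicComplexInt p) : ℂ_[p])‖ *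
      ‖((coeff n (coeff m G) : PadicComplexInt p) : ℂ_[p])‖ ≤ b := by
  have hb : 0 ≤ b := (norm_nonneg _).trans (h 0 0)
  by_cases hF : coeff l (coeff k F) = 0
  · simpa [hF] using hb
  by_cases hG : coeff n (coeff m G) = 0
  · simpa [hG] using hb
  set x : ℝ := ‖((coeff l (coeff k F) : PadicComplexInt p) : ℂ_[p])‖ *
      ‖((coeff n (coeff m G) : PadicComplexInt p) : ℂ_[p])‖ with hx
  have hx0 : 0 < x := mul_pos (norm_pos_of_ne_zero hF) (norm_pos_of_ne_zero hG)
  set M : ℕ := k + l + (m + n) with hM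
  have hp1 : (1 : ℝ) ≤ p := by exact_mod_cast (Fact.out : p.Prime).one_lt.le
  -- Step 1: for every `N ≥ 1`, `(p⁻¹)^M · x^N ≤ b^N`
  have key : ∀ N : ℕ, 0 < N → ((p : ℝ)⁻¹) ^ M * x ^ N ≤ b ^ N := by
    intro N hN
    obtain ⟨ϖ, hϖN, h0, h1⟩ := exists_root_of_p (p := p) N hN
    -- normalise both factors after rescaling
    obtain ⟨γ, F', hF', hγ, i₁, j₁, h1F⟩ := exists_normalisation h0 h1 F k l hF
    obtain ⟨δ, G', hG', hδ, i₂, j₂, h1G⟩ := exists_normalisation h0 h1 G m n hG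
    -- a unit coefficient of `F' · G'` (reduction mod 𝔪 lands in a domain)
    have hprod : PowerSeries.map (PowerSeries.map (IsLocalRing.residue (PadicComplexInt p))) (F' * G') ≠ 0 := by
      rw [map_mul]
      exact mul_ne_zero (map_residue_ne_zero_of_coeff_eq_one h1F) (map_residue_ne_zero_of_coeff_eq_one h1G)
    obtain ⟨a, b', hab⟩ := exists_coeff_coeff_ne_zero hprod
    have hunit : IsUnit (coeff b' (coeff a (F' * G'))) := by
      rw [coeff_map, coeff_map] at hab
      by_contra hnu
      exact hab ((IsLocalRing.residue_eq_zero_iff _).mpr ((IsLocalRing.mem_maximalIdeal _).mpr hnu))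
    have hn1 : ‖((coeff b' (coeff a (F' * G')) : PadicComplexInt p) : ℂ_[p])‖ = 1 :=
      isUnit_padicComplexInt_iff.mp hunit
    -- the rescaled product at `(a, b')`
    have hprodφ : ((rescale (C ϖ)).comp (PowerSeries.map (rescale ϖ))) (F * G) =
        C (C (γ * δ)) * (F' * G') := by
      rw [map_mul, hF', hG', map_mul, map_mul]; ring
    have hcoef : ϖ ^ a * ϖ ^ b' * coeff b' (coeff a (F * G)) = γ * δ * coeff b' (coeff a (F' * G')) := by
      rw [← coeff_coeff_rescale₂, ← coeff_coeff_C_C_mul]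
      exact congr_arg (fun H ↦ coeff b' (coeff a H)) hprodφ
    have hnorm : ‖(ϖ : ℂ_[p])‖ ^ a * ‖(ϖ : ℂ_[p])‖ ^ b' *
        ‖((coeff b' (coeff a (F * G)) : PadicComplexInt p) : ℂ_[p])‖ =
        ‖(γ : ℂ_[p])‖ * ‖(δ : ℂ_[p])‖ := by
      have h' := congr_arg (fun y : PadicComplexInt p ↦ ‖(y : ℂ_[p])‖) hcoef
      push_cast at h'
      rw [norm_mul, norm_mul, norm_pow, norm_pow, norm_mul, norm_mul, hn1, mul_one] at h'
      exact h'
    -- hence `‖γ‖‖δ‖ ≤ b`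
    have hγδ : ‖(γ : ℂ_[p])‖ * ‖(δ : ℂ_[p])‖ ≤ b := by
      rw [← hnorm]
      calc ‖(ϖ : ℂ_[p])‖ ^ a * ‖(ϖ : ℂ_[p])‖ ^ b' *
            ‖((coeff b' (coeff a (F * G)) : PadicComplexInt p) : ℂ_[p])‖
          ≤ 1 * 1 * b := by
            gcongr
            · exact pow_le_one₀ (norm_nonneg _) h1.le
            · exact pow_le_one₀ (norm_nonneg _) h1.le
            · exact h a b'
        _ = b := by ring
    -- and `‖ϖ‖^M · x ≤ ‖γ‖‖δ‖ ≤ b`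
    have hstep : ‖(ϖ : ℂ_[p])‖ ^ M * x ≤ b := by
      calc ‖(ϖ : ℂ_[p])‖ ^ M * x
          = (‖(ϖ : ℂ_[p])‖ ^ (k + l) * ‖((coeff l (coeff k F) : PadicComplexInt p) : ℂ_[p])‖) *
            (‖(ϖ : ℂ_[p])‖ ^ (m + n) * ‖((coeff n (coeff m G) : PadicComplexInt p) : ℂ_[p])‖) := by
            rw [hM, pow_add]; ring
        _ ≤ ‖(γ : ℂ_[p])‖ * ‖(δ : ℂ_[p])‖ := by gcongr
        _ ≤ b := hγδ
    -- raise to the `N`-th power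
    have hpowN : (‖(ϖ : ℂ_[p])‖ ^ M * x) ^ N ≤ b ^ N := pow_le_pow_left₀ (by positivity) hstep N
    calc ((p : ℝ)⁻¹) ^ M * x ^ N = (‖(ϖ : ℂ_[p])‖ ^ M * x) ^ N := by rw [← hϖN]; ring
      _ ≤ b ^ N := hpowN
  -- Step 2: let `N → ∞`
  refine le_of_not_gt fun hlt ↦ ?_
  have hpM : 0 < ((p : ℝ)⁻¹) ^ M := by positivity
  have hpM1 : ((p : ℝ)⁻¹) ^ M ≤ 1 := pow_le_one₀ (by positivity) (inv_le_one_of_one_le₀ hp1)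
  have hr1 : b / x < 1 := (div_lt_one hx0).mpr hlt
  obtain ⟨N, hN⟩ := exists_pow_lt_of_lt_one hpM hr1
  have hNpos : 0 < N := by
    rcases Nat.eq_zero_or_pos N with rfl | hN'
    · rw [pow_zero] at hN
      linarith
    · exact hN'
  have hkey := key N hNpos
  have hdiv : ((p : ℝ)⁻¹) ^ M ≤ (b / x) ^ N := by
    rw [div_pow, le_div_iff₀ (pow_pos hx0 N)]
    exact hkey
  linarith

/-- **One-variable case** (the line `T₁ = 0`): if every coefficient of `f · g ∈ 𝒪_{ℂ_p}⟦T⟧` has norm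
`≤ b` then `‖f_l‖ · ‖g_n‖ ≤ b` — the two-variable inequality for the `T₁`-constant series `C f`, `C g`.
[cite: BourbakiAC5to7, Ch. VII §3 (Gauss's lemma)] -/
theorem norm_coeff_mul_norm_coeff_le₁ (f g : PowerSeries (PadicComplexInt p)) {b : ℝ}
    (h : ∀ j, ‖((coeff j (f * g) : PadicComplexInt p) : ℂ_[p])‖ ≤ b) (l n : ℕ) :
    ‖((coeff l f : PadicComplexInt p) : ℂ_[p])‖ * ‖((coeff n g : PadicComplexInt p) : ℂ_[p])‖ ≤ b := by
  have hb : 0 ≤ b := (norm_nonneg _).trans (h 0)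
  have h2 : ∀ i j, ‖((coeff j (coeff i (C f * C g)) : PadicComplexInt p) : ℂ_[p])‖ ≤ b := by
    intro i j
    rw [← map_mul, coeff_C]
    split_ifs
    · exact h j
    · simpa using hb
  simpa [coeff_zero_C] using norm_coeff_mul_norm_coeff_le (C f) (C g) h2 0 l 0 n


end Summit.BirchSwinnertonDyer.BirchSwinnertonDyer.Theorems.SmallImageGaussInequality

end
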